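import Literature.Barriers.NavierStokesRegularity.SingularSetDimensionBound
import Literature.Analysis.FluidPDE.PartialRegularityHolds
import Literature.Analysis.FluidPDE.SchefferSingularTimesProofs
import HarnessLib

/-!
# Barrier `SingularSetDimensionBound` — discharged

Barrier-catalogue glue file for `NavierStokesRegularity` (D-0021) **discharging the barrier fact
`Literature.Barriers.NavierStokesRegularity.SingularSetDimensionBound`**
(`SingularSetDimensionBound.lean`: the conjunction of Caffarelli–Kohn–Nirenberg 1982, Theorem B —
the singular set of a suitable weak solution is `𝒫¹`-null — and Leray 1934, §34 / Scheffer 1977 —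
the singular times of a Leray–Hopf solution are `ℋ^{1/2}`-null). Both conjuncts are now theorems
of the tree: `Literature.Analysis.FluidPDE.ckn_partial_regularity_holds`
(`Literature/Analysis/FluidPDE/PartialRegularityHolds.lean`, from Robinson–Rodrigo–Sadowski's
Lemma 15.12, fully proved) and `Literature.Analysis.FluidPDE.scheffer_singular_times_holds`
(`Literature/Analysis/FluidPDE/SchefferSingularTimesProofs.lean`, from the local `H¹` regularity
theorem for Leray–Hopf solutions, fully proved); the accepted in-file glue
`singularSetDimensionBound_of` assembles them. The barrier is therefore an unconditional
theorem (`SingularSetDimensionBound_holds`); its structured docstring (technique class, blocks,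
because, evasions, scope) is unchanged in `SingularSetDimensionBound.lean`.

Theorem-only glue module: no definitions, no named facts, no `sorry`.

## References

* L. Caffarelli, R. Kohn, L. Nirenberg, *Partial regularity of suitable weak solutions of the
  Navier–Stokes equations*, Comm. Pure Appl. Math. 35 (1982), 771–831, Theorem B.
  [CaffarelliKohnNirenberg1982] [CKN1982]
* J. Leray, *Sur le mouvement d'un liquide visqueux emplissant l'espace*, Acta Math. 63 (1934),
  §34. [Leray1934]
* V. Scheffer, *Turbulence and Hausdorff dimension*, Comm. Math. Phys. 55 (1977), 97–112.
* J. C. Robinson, J. L. Rodrigo, W. Sadowski, *The Three-Dimensional Navier–Stokes Equations*,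
  CUP (2016), Thm. 8.14, Cor. 8.16, Thm. 15.3, Lemma 15.12. [RobinsonRodrigoSadowski2016]
-/

noncomputable section

namespace Literature.Barriers.NavierStokesRegularity

/-- **The barrier `SingularSetDimensionBound` holds unconditionally**: CKN's Theorem B and the
Leray–Scheffer singular-times bound, both proved in the tree, assembled by
`singularSetDimensionBound_of`. [cite: CaffarelliKohnNirenberg1982, Theorem B] -/
theorem SingularSetDimensionBound_holds : SingularSetDimensionBound :=
  singularSetDimensionBound_of Literature.Analysis.FluidPDE.ckn_partial_regularity_holds
    Literature.Analysis.FluidPDE.scheffer_singular_times_holds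

end Literature.Barriers.NavierStokesRegularity
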